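import Literature.NumberTheory.LFunctions.ZetaScrewNonArchSign
import HarnessLib

/-!
# Suzuki, *On variants of Chebyshev's conjecture* — Theorem 2 (first assertion): RH from the
# eventual non-positivity of `Σ_{n ≤ xe²} Λ(n) n^{-1/2} log(x/n)`

M. Suzuki, *On variants of Chebyshev's conjecture*, Ramanujan J. **68** (2025), article 95
= arXiv:2411.07436 [Suzuki2025Chebyshev] (the tree's bib key of record; `Suzuki2024` names the
arXiv version), **Theorem 2**, AS PRINTED (arXiv p. 3):

> «Suppose that there exists an `x₀ ≥ 2` such that `Σ_{n ≤ xe²} Λ(n) n^{-1/2} log(x/n) ≤ 0` holds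
> for all `x ≥ x₀`. Then, the RH holds. Furthermore, it holds that
> `lim_{x→∞} Σ_{n ≤ xe²} Λ(n) n^{-1/2}(1 − log n/log x) = −(ζ'/ζ)(1/2)` if and only if the RH holds
> and the estimate `Σ_ρ x^ρ/ρ = o(√x log x)` is valid as `x → ∞`.»

This file PROVES the first assertion (`Suzuki2025_thm2`): an RH-FREE implication whose
hypothesis is of (at least) RH strength («(1.10) and (1.11) may provide a condition stronger than
the RH», p. 3). The second assertion (an equivalence with RH **and** `Σ_ρ x^ρ/ρ = o(√x log x)`,
via the explicit formula (3.1)) is not formalised here. The sibling results of the same paper —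
Theorem 1 (i) ⟺ (ii) and Corollary 1 — are the tree's `Suzuki2025_thm1`, `Suzuki2025_cor1`
(`ZetaScrewNonArchSign.lean`) and the discharged fact `Suzuki2024_thm1` (`ChebyshevHalfLineBias.lean`).

## Proof (the paper's §3.1, «as an analog of Theorem 1»)

With `y = xe²` the hypothesis reads `φ(t) − 2Π(t) ≤ 0` for `t = log y ≥ log x₀ + 2`, where
`φ(t) = Σ_{n ≤ e^t} Λ(n) n^{-1/2}(t − log n)` is the prime sum of the screw function (the tree's
`zetaScrewPrimeSum`) and `Π(t) = Σ_{n ≤ e^t} Λ(n) n^{-1/2}` its right derivative. For `Re S > 1`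
the Laplace transforms are `∫_0^∞ φ(t)e^{−St} dt = S^{−2} L(Λ, ½+S)` (Suzuki 2023 (2.3), the tree's
`ZetaScrewLaplace.integral_primeSum_mul_cexp`) and `∫_0^∞ Π(t)e^{−St} dt = S^{−1} L(Λ, ½+S)`
(termwise: `∫_0^∞ 𝟙[log n ≤ t] e^{−St} dt = n^{−S}/S`; proved here), so that
`∫_0^∞ (2Π − φ)(t) e^{−St} dt = (2S − 1) S^{−2} L(Λ, ½+S) = ((1 − 2S)·ζ₁'/ζ₁(½+S) + 2)/S²`
(`L(Λ, w) = −ζ'/ζ(w) = 1/(w−1) − ζ₁'/ζ₁(w)`, `ζ₁(w) = (w−1)ζ(w)`). Landau's theorem for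
transforms of the shape `(c(S)·ζ₁'/ζ₁(½+S) + P(S))/S²` with `c`, `P` holomorphic on `Re S > 0` and
`c ≠ 0` on `0 < Re S < ½` (`riemannHypothesis_of_laplace_eq_mul`, the tree's engine
`ZetaScrewNonArchSign.riemannHypothesis_of_laplace_eq` with a holomorphic coefficient in front of
`ζ₁'/ζ₁`; same proof: Landau's theorem gives holomorphy of the transform on `Re S > 0`, and at an
off-line zero `w₀` of `ζ₁(½ + ·)` the identity `(F S² − P)·ζ₁(½+S) = c(S)·ζ₁'(½+S)` is impossible
by comparing orders since `c(w₀) ≠ 0`) then gives RH. Here `c(S) = 1 − 2S`, `P = 2`.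

All statements in this file are proved (0 named facts); no new definitions.

## References

* [Suzuki2025Chebyshev] M. Suzuki, Ramanujan J. 68 (2025) 95 = arXiv:2411.07436, Thm. 2, §2 Prop. 1,
  §3.1.
* [Suzuki2023] M. Suzuki, J. Lond. Math. Soc. (2) 108 (2023) 1448–1487, §2.1 (2.3) (Laplace transform
  of the prime sum).
-/

noncomputable section

open Complex Filter Topology Set MeasureTheory ArithmeticFunction
open scoped Real LSeries.notation

namespace Literature.NumberTheory.LFunctions

namespace HalfLinePrimeSumLandau

open ZetaScrewLandau

variable {a : ℂ}

/-! ### The half-line prime-power count `Π(t) = Σ_{n ≤ e^t} Λ(n) n^{-1/2}` -/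

/-- `Π(t) = Σ_{1 ≤ n ≤ e^t} Λ(n)/√n` is non-decreasing. [folklore] -/
private theorem monotone_primeCount :
    Monotone fun t : ℝ ↦ ∑ n ∈ Finset.Icc 1 ⌊Real.exp t⌋₊, Λ n / Real.sqrt n := by
  intro t u htu
  refine Finset.sum_le_sum_of_subset_of_nonneg
    (Finset.Icc_subset_Icc_right (Nat.floor_mono (Real.exp_le_exp.2 htu))) fun _ _ _ ↦ ?_
  exact div_nonneg vonMangoldt_nonneg (Real.sqrt_nonneg _)

/-- `Π` is (Borel) measurable, being monotone. [folklore] -/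
private theorem measurable_primeCount :
    Measurable fun t : ℝ ↦ ∑ n ∈ Finset.Icc 1 ⌊Real.exp t⌋₊, Λ n / Real.sqrt n :=
  monotone_primeCount.measurable

/-- `Π ≥ 0`. [folklore] -/
private theorem primeCount_nonneg (t : ℝ) : 0 ≤ ∑ n ∈ Finset.Icc 1 ⌊Real.exp t⌋₊, Λ n / Real.sqrt n :=
  Finset.sum_nonneg fun _ _ ↦ div_nonneg vonMangoldt_nonneg (Real.sqrt_nonneg _)

/-- For `t ≥ 0`: `Π(t) = Σ_{n ≥ 0} Λ(n) n^{-1/2} 𝟙[log n ≤ t]` (a finitely supported sum). [folklore] -/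
private theorem hasSum_countTerm (t : ℝ) :
    HasSum (fun n : ℕ ↦ Λ n / Real.sqrt n * (if Real.log n ≤ t then (1 : ℝ) else 0))
      (∑ n ∈ Finset.Icc 1 ⌊Real.exp t⌋₊, Λ n / Real.sqrt n) := by
  have hS : ∑ n ∈ Finset.Icc 1 ⌊Real.exp t⌋₊, Λ n / Real.sqrt n * (if Real.log n ≤ t then (1 : ℝ) else 0)
      = ∑ n ∈ Finset.Icc 1 ⌊Real.exp t⌋₊, Λ n / Real.sqrt n := by
    refine Finset.sum_congr rfl fun n hn ↦ ?_
    rw [Finset.mem_Icc] at hn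
    have hn0 : (0 : ℝ) < n := by exact_mod_cast hn.1
    have hle : Real.log n ≤ t := by
      rw [Real.log_le_iff_le_exp hn0]
      exact le_trans (by exact_mod_cast hn.2) (Nat.floor_le (Real.exp_pos t).le)
    rw [if_pos hle, mul_one]
  rw [← hS]
  refine hasSum_sum_of_ne_finset_zero fun n hn ↦ ?_
  rw [Finset.mem_Icc, not_and_or, not_le, not_le] at hn
  rcases hn with hn | hn
  · have : n = 0 := by omega
    subst this
    simp
  · have hn0 : (0 : ℝ) < n := by exact_mod_cast lt_of_le_of_lt (Nat.zero_le _) hn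
    have hlt : t < Real.log n := by
      rw [Real.lt_log_iff_exp_lt hn0]
      exact Nat.lt_of_floor_lt hn
    rw [if_neg (not_le.2 hlt), mul_zero]

/-! ### Laplace transforms of the indicator kernels `𝟙[ℓ ≤ t]` -/

/-- `𝟙[ℓ ≤ t] e^{at}` is integrable on `(0, ∞)` for `Re a < 0`. [folklore] -/
private theorem integrableOn_indicator_mul_cexp (ℓ : ℝ) (ha : a.re < 0) :
    IntegrableOn (fun t : ℝ ↦ ((if ℓ ≤ t then (1 : ℝ) else 0 : ℝ) : ℂ) * cexp (a * t)) (Ioi 0) := by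
  refine Integrable.mono (integrableOn_exp_mul_complex_Ioi ha 0) ?_ ?_
  · refine AEStronglyMeasurable.mul ?_ (by fun_prop)
    refine (Complex.measurable_ofReal.comp ?_).aestronglyMeasurable
    exact Measurable.ite measurableSet_Ici measurable_const measurable_const
  · refine (ae_restrict_mem measurableSet_Ioi).mono fun t _ ↦ ?_
    by_cases h : ℓ ≤ t
    · simp [h]
    · simp [h]

/-- `∫_0^∞ 𝟙[ℓ ≤ t] e^{at} dt = −e^{aℓ}/a` for `ℓ ≥ 0`, `Re a < 0` (the termwise transform of `Π`:
`∫_0^∞ 𝟙[log n ≤ t] e^{−St} dt = n^{−S}/S`). [folklore] -/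
private theorem integral_indicator_mul_cexp {ℓ : ℝ} (hℓ : 0 ≤ ℓ) (ha : a.re < 0) :
    ∫ t in Ioi (0 : ℝ), ((if ℓ ≤ t then (1 : ℝ) else 0 : ℝ) : ℂ) * cexp (a * t) =
      -cexp (a * ℓ) / a := by
  have h1 : (fun t : ℝ ↦ ((if ℓ ≤ t then (1 : ℝ) else 0 : ℝ) : ℂ) * cexp (a * t)) =
      (Ici ℓ).indicator (fun t : ℝ ↦ cexp (a * t)) := by
    funext t
    by_cases h : ℓ ≤ t
    · rw [if_pos h, indicator_of_mem (mem_Ici.2 h), Complex.ofReal_one, one_mul]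
    · rw [if_neg h, indicator_of_notMem (fun h' ↦ h (mem_Ici.1 h')), Complex.ofReal_zero, zero_mul]
  rw [h1, setIntegral_indicator measurableSet_Ici]
  rcases hℓ.eq_or_lt with h0 | hpos
  · rw [← h0, Set.inter_eq_left.2 Ioi_subset_Ici_self, integral_exp_mul_complex_Ioi ha 0]
  · rw [Set.inter_eq_right.2 (Ici_subset_Ioi.2 hpos), integral_Ici_eq_integral_Ioi,
      integral_exp_mul_complex_Ioi ha ℓ]

/-- Real form: `∫_0^∞ 𝟙[ℓ ≤ t] e^{rt} dt = −e^{rℓ}/r` (`ℓ ≥ 0`, `r < 0`). [folklore] -/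
private theorem integral_indicator_mul_exp {ℓ r : ℝ} (hℓ : 0 ≤ ℓ) (hr : r < 0) :
    ∫ t in Ioi (0 : ℝ), (if ℓ ≤ t then (1 : ℝ) else 0) * Real.exp (r * t) =
      -Real.exp (r * ℓ) / r := by
  have h1 : (fun t : ℝ ↦ (if ℓ ≤ t then (1 : ℝ) else 0) * Real.exp (r * t)) =
      (Ici ℓ).indicator (fun t : ℝ ↦ Real.exp (r * t)) := by
    funext t
    by_cases h : ℓ ≤ t
    · rw [if_pos h, indicator_of_mem (mem_Ici.2 h), one_mul]
    · rw [if_neg h, indicator_of_notMem (fun h' ↦ h (mem_Ici.1 h')), zero_mul]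
  rw [h1, setIntegral_indicator measurableSet_Ici]
  rcases hℓ.eq_or_lt with h0 | hpos
  · rw [← h0, Set.inter_eq_left.2 Ioi_subset_Ici_self, integral_exp_mul_Ioi hr 0]
  · rw [Set.inter_eq_right.2 (Ici_subset_Ioi.2 hpos), integral_Ici_eq_integral_Ioi,
      integral_exp_mul_Ioi hr ℓ]

/-- The termwise transform equals `−a^{-1} Λ(n) n^{-s}`, `s = 1/2 − a`:
`Λ(n) n^{-1/2} · (−n^{a}/a) = −a^{-1} Λ(n)/n^{s}`. [folklore] -/
private theorem countTerm_integral_eq_term {n : ℕ} (a : ℂ) (ha0 : a ≠ 0) :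
    ((Λ n / Real.sqrt n : ℝ) : ℂ) * (-cexp (a * (Real.log n : ℝ)) / a) =
      -(1 / a) * LSeries.term (fun n ↦ (Λ n : ℂ)) (1 / 2 - a) n := by
  rcases eq_or_ne n 0 with rfl | hn
  · simp
  have hsqrt : (Real.sqrt n : ℂ) ≠ 0 :=
    ofReal_ne_zero.2 (Real.sqrt_ne_zero'.2 (by exact_mod_cast Nat.pos_of_ne_zero hn))
  have hna : (n : ℂ) ^ a ≠ 0 := cpow_ne_zero_iff.2 (Or.inl (Nat.cast_ne_zero.2 hn))
  rw [LSeries.term_of_ne_zero hn, ZetaScrewLaplace.natCast_cpow_half_sub hn,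
    ZetaScrewLaplace.cexp_mul_log_natCast hn]
  push_cast
  field_simp

/-- The `L¹` norm of the terms: `Λ(n) n^{-1/2} e^{r log n} = ‖Λ(n) n^{-(1/2 − a)}‖` (`r = Re a`).
[folklore] -/
private theorem countTerm_norm_eq {n : ℕ} (a : ℂ) :
    Λ n / Real.sqrt n * Real.exp (a.re * Real.log n) =
      ‖LSeries.term (fun n ↦ (Λ n : ℂ)) (1 / 2 - a) n‖ := by
  rcases eq_or_ne n 0 with rfl | hn
  · simp
  have hn0 : (0 : ℝ) < n := by exact_mod_cast Nat.pos_of_ne_zero hn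
  rw [LSeries.norm_term_eq, if_neg hn, Complex.norm_real, Real.norm_eq_abs,
    abs_of_nonneg vonMangoldt_nonneg]
  have hre : (1 / 2 - a).re = 1 / 2 - a.re := by simp
  rw [hre, Real.rpow_sub hn0, ← Real.sqrt_eq_rpow, mul_comm (a.re) (Real.log n),
    ← Real.rpow_def_of_pos hn0]
  have hsqrt : Real.sqrt n ≠ 0 := Real.sqrt_ne_zero'.2 hn0
  have hpow : (n : ℝ) ^ a.re ≠ 0 := (Real.rpow_pos_of_pos hn0 _).ne'
  field_simp

/-- **Laplace transform of the half-line prime-power count**: for `Re a < −1/2`,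
`t ↦ Π(t) e^{at}` is integrable on `(0, ∞)` and `∫₀^∞ Π(t) e^{at} dt = −a^{-1} Σ_n Λ(n) n^{-(1/2-a)}`
(termwise, the interchange justified by absolute convergence of `L(Λ, ½ − Re a)`).
[cite: Suzuki2025Chebyshev, §3.1 (the transform of `ψ_{1/2}`, cf. (3.4))] -/
theorem integral_primeCount_mul_cexp (ha : a.re < -1 / 2) :
    IntegrableOn (fun t : ℝ ↦
        ((∑ n ∈ Finset.Icc 1 ⌊Real.exp t⌋₊, Λ n / Real.sqrt n : ℝ) : ℂ) * cexp (a * t)) (Ioi 0) ∧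
      ∫ t in Ioi (0 : ℝ),
          ((∑ n ∈ Finset.Icc 1 ⌊Real.exp t⌋₊, Λ n / Real.sqrt n : ℝ) : ℂ) * cexp (a * t) =
        -(1 / a) * L ↗Λ (1 / 2 - a) := by
  have ha' : a.re < 0 := by linarith
  have ha0 : a ≠ 0 := fun h ↦ by rw [h] at ha'; simp at ha'
  have hre0 : a.re ≠ 0 := ha'.ne
  have hs : 1 < (1 / 2 - a).re := by simp; linarith
  set μ : Measure ℝ := volume.restrict (Ioi 0) with hμ
  set Pc : ℝ → ℝ := fun t ↦ ∑ n ∈ Finset.Icc 1 ⌊Real.exp t⌋₊, Λ n / Real.sqrt n with hPc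
  -- the terms
  set F : ℕ → ℝ → ℂ := fun n t ↦
    ((Λ n / Real.sqrt n : ℝ) : ℂ) *
      ((((if Real.log n ≤ t then (1 : ℝ) else 0 : ℝ)) : ℂ) * cexp (a * t)) with hF
  have hlog : ∀ n : ℕ, 0 ≤ Real.log n := fun n ↦ Real.log_natCast_nonneg n
  have hF_int : ∀ n, Integrable (F n) μ := fun n ↦
    (integrableOn_indicator_mul_cexp (Real.log n) ha').const_mul _
  -- their integrals
  have hF_val : ∀ n, ∫ t, F n t ∂μ = -(1 / a) * LSeries.term (fun n ↦ (Λ n : ℂ)) (1 / 2 - a) n := by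
    intro n
    simp only [hF, hμ]
    rw [integral_const_mul, integral_indicator_mul_cexp (hlog n) ha', countTerm_integral_eq_term a ha0]
  -- their `L¹` norms
  have hF_norm : ∀ n, ∫ t, ‖F n t‖ ∂μ =
      1 / (-a.re) * ‖LSeries.term (fun n ↦ (Λ n : ℂ)) (1 / 2 - a) n‖ := by
    intro n
    have hpt : ∀ t ∈ Ioi (0 : ℝ), ‖F n t‖ =
        Λ n / Real.sqrt n * ((if Real.log n ≤ t then (1 : ℝ) else 0) * Real.exp (a.re * t)) := by
      intro t _
      simp only [hF, norm_mul, Complex.norm_real, Real.norm_eq_abs,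
        ZetaScrewLaplace.norm_cexp_mul_ofReal,
        abs_of_nonneg (div_nonneg vonMangoldt_nonneg (Real.sqrt_nonneg _))]
      by_cases h : Real.log n ≤ t
      · rw [if_pos h, abs_one]
      · rw [if_neg h, abs_zero]
    simp only [hμ]
    rw [setIntegral_congr_fun measurableSet_Ioi hpt, integral_const_mul,
      integral_indicator_mul_exp (hlog n) ha', ← countTerm_norm_eq a]
    field_simp
  have hF_sum : Summable fun n ↦ ∫ t, ‖F n t‖ ∂μ := by
    simp_rw [hF_norm]
    exact (LSeriesSummable_vonMangoldt hs).norm.mul_left _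
  -- pointwise sums on `(0, ∞)`
  have hpt : ∀ t ∈ Ioi (0 : ℝ), HasSum (fun n ↦ F n t) ((Pc t : ℂ) * cexp (a * t)) := by
    intro t _
    have h := (Complex.hasSum_ofReal.2 (hasSum_countTerm t)).mul_right (cexp (a * t))
    refine h.congr_fun fun n ↦ ?_
    simp only [hF]
    push_cast
    ring
  have hpt_norm : ∀ t ∈ Ioi (0 : ℝ),
      HasSum (fun n ↦ ‖F n t‖) ‖(Pc t : ℂ) * cexp (a * t)‖ := by
    intro t _
    have h := (hasSum_countTerm t).mul_right (Real.exp (a.re * t))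
    rw [norm_mul, Complex.norm_real, Real.norm_eq_abs, abs_of_nonneg (primeCount_nonneg t),
      ZetaScrewLaplace.norm_cexp_mul_ofReal]
    refine h.congr_fun fun n ↦ ?_
    simp only [hF, norm_mul, Complex.norm_real, Real.norm_eq_abs,
      ZetaScrewLaplace.norm_cexp_mul_ofReal,
      abs_of_nonneg (div_nonneg vonMangoldt_nonneg (Real.sqrt_nonneg _))]
    by_cases h' : Real.log n ≤ t
    · rw [if_pos h', abs_one]; ring
    · rw [if_neg h', abs_zero]; ring
  -- integrability of `Π e^{at}`
  have hmeas : AEStronglyMeasurable (fun t : ℝ ↦ (Pc t : ℂ) * cexp (a * t)) μ :=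
    ((Complex.measurable_ofReal.comp measurable_primeCount).mul
      (by fun_prop : Continuous fun t : ℝ ↦ cexp (a * t)).measurable).aestronglyMeasurable
  have hint : IntegrableOn (fun t : ℝ ↦ (Pc t : ℂ) * cexp (a * t)) (Ioi 0) := by
    refine ZetaScrewLaplace.integrable_of_hasSum_norm (μ := μ) hmeas hF_int hF_sum ?_
    exact (ae_restrict_mem measurableSet_Ioi).mono hpt_norm
  refine ⟨hint, ?_⟩
  -- interchange of sum and integral
  have hsum := hasSum_integral_of_summable_integral_norm hF_int hF_sum
  have heq : ∫ t, (∑' n, F n t) ∂μ = ∫ t in Ioi (0 : ℝ), (Pc t : ℂ) * cexp (a * t) := by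
    simp only [hμ]
    exact setIntegral_congr_fun measurableSet_Ioi fun t ht ↦ (hpt t ht).tsum_eq
  rw [heq] at hsum
  simp_rw [hF_val] at hsum
  have hL : HasSum (fun n ↦ -(1 / a) * LSeries.term (fun n ↦ (Λ n : ℂ)) (1 / 2 - a) n)
      (-(1 / a) * L (fun n ↦ (Λ n : ℂ)) (1 / 2 - a)) :=
    (LSeriesSummable_vonMangoldt hs).hasSum.mul_left _
  exact hsum.unique hL

/-- `(2Π(t) − φ(t)) e^{at}` is integrable on `(0, ∞)` for `Re a < −1/2`. [folklore] -/
private theorem integrableOn_two_primeCount_sub_primeSum_mul_cexp (ha : a.re < -1 / 2) :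
    IntegrableOn (fun t : ℝ ↦
        ((2 * (∑ n ∈ Finset.Icc 1 ⌊Real.exp t⌋₊, Λ n / Real.sqrt n) - zetaScrewPrimeSum t : ℝ) : ℂ) *
          cexp (a * t)) (Ioi 0) := by
  obtain ⟨hi₁, -⟩ := integral_primeCount_mul_cexp ha
  obtain ⟨hi₂, -⟩ := ZetaScrewLaplace.integral_primeSum_mul_cexp ha
  have hi : IntegrableOn (fun t : ℝ ↦
      2 * (((∑ n ∈ Finset.Icc 1 ⌊Real.exp t⌋₊, Λ n / Real.sqrt n : ℝ) : ℂ) * cexp (a * t)) -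
        (zetaScrewPrimeSum t : ℂ) * cexp (a * t)) (Ioi 0) := (hi₁.const_mul 2).sub hi₂
  refine hi.congr_fun (fun t _ ↦ ?_) measurableSet_Ioi
  push_cast
  ring

/-- The transform of `G = 2Π − φ` in the Landau variable: for `Re S > 1`,
`∫_0^∞ (2Π(t) − φ(t)) e^{−St} dt = ((1 − 2S)·ζ₁'/ζ₁(1/2+S) + 2)/S²` (`= (2S−1) S^{−2} L(Λ, ½+S)`).
[cite: Suzuki2025Chebyshev, §3.1] -/
theorem laplace_two_primeCount_sub_primeSum {s : ℂ} (hs : 1 < s.re) :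
    IntegrableOn (fun t : ℝ ↦
        ((2 * (∑ n ∈ Finset.Icc 1 ⌊Real.exp t⌋₊, Λ n / Real.sqrt n) - zetaScrewPrimeSum t : ℝ) : ℂ) *
          cexp (-s * t)) (Ioi 0) ∧
      ∫ t in Ioi (0 : ℝ),
          ((2 * (∑ n ∈ Finset.Icc 1 ⌊Real.exp t⌋₊, Λ n / Real.sqrt n) - zetaScrewPrimeSum t : ℝ) : ℂ) *
            cexp (-s * t) =
        ((1 - 2 * s) * logDeriv riemannZeta₁ (1 / 2 + s) + 2) / s ^ 2 := by
  have ha : (-s).re < -1 / 2 := by simp; linarith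
  obtain ⟨hi₁, hI₁⟩ := integral_primeCount_mul_cexp ha
  obtain ⟨hi₂, hI₂⟩ := ZetaScrewLaplace.integral_primeSum_mul_cexp ha
  set f₁ : ℝ → ℂ := fun t ↦
    ((∑ n ∈ Finset.Icc 1 ⌊Real.exp t⌋₊, Λ n / Real.sqrt n : ℝ) : ℂ) * cexp (-s * t) with hf₁
  set f₂ : ℝ → ℂ := fun t ↦ (zetaScrewPrimeSum t : ℂ) * cexp (-s * t) with hf₂
  have heq : EqOn (fun t : ℝ ↦
      ((2 * (∑ n ∈ Finset.Icc 1 ⌊Real.exp t⌋₊, Λ n / Real.sqrt n) - zetaScrewPrimeSum t : ℝ) : ℂ) *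
        cexp (-s * t)) (fun t ↦ 2 * f₁ t - f₂ t) (Ioi 0) := by
    intro t _
    simp only [hf₁, hf₂]
    push_cast
    ring
  have hi : IntegrableOn (fun t ↦ 2 * f₁ t - f₂ t) (Ioi 0) := (hi₁.const_mul 2).sub hi₂
  refine ⟨hi.congr_fun heq.symm measurableSet_Ioi, ?_⟩
  rw [setIntegral_congr_fun measurableSet_Ioi heq, integral_sub (hi₁.const_mul 2) hi₂,
    integral_const_mul, hI₁, hI₂, show (1 / 2 : ℂ) - -s = 1 / 2 + s by ring]
  have hL : L ↗Λ (1 / 2 + s) = 1 / (1 / 2 + s - 1) - logDeriv riemannZeta₁ (1 / 2 + s) := by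
    have := logDeriv_riemannZeta₁_eq_of_one_lt_re (s := 1 / 2 + s) (by simp; linarith)
    rw [this]
    ring
  rw [hL]
  have hs0 : s ≠ 0 := fun h ↦ by rw [h, zero_re] at hs; linarith
  have hq : s - 1 / 2 ≠ 0 := by
    intro h
    have := congrArg Complex.re h
    simp at this
    linarith
  have hq2 : (2 * s - 1 : ℂ) ≠ 0 := by
    intro h; apply hq; linear_combination h / 2
  set LD := logDeriv riemannZeta₁ (1 / 2 + s)
  have e3 : (1 / 2 + s - 1 : ℂ) = (2 * s - 1) / 2 := by ring
  rw [e3]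
  field_simp
  ring

/-! ### Landau's theorem for transforms `(c(S)·ζ₁'/ζ₁(1/2+S) + P(S))/S²` -/

/-- `∫_1^∞ G(log x) x^{-(s+1)} dx = ∫_0^∞ G(t) e^{-st} dt` (substitution `x = e^t`). [folklore] -/
private theorem mellinIoi_comp_log (G : ℝ → ℝ) (s : ℂ) :
    Landau.mellinIoi (fun x ↦ G (Real.log x)) s =
      ∫ t in Ioi (0 : ℝ), (G t : ℂ) * cexp (-s * t) := by
  unfold Landau.mellinIoi
  rw [integral_Ioi_one_eq_integral_Ioi_zero]
  refine setIntegral_congr_fun measurableSet_Ioi fun t _ ↦ ?_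
  dsimp only
  rw [Real.log_exp, ofReal_exp_cpow, Complex.real_smul, Complex.ofReal_exp]
  have : cexp (t : ℂ) * cexp ((t : ℂ) * -(s + 1)) = cexp (-s * t) := by
    rw [← Complex.exp_add]
    congr 1
    ring
  rw [← this]
  ring

/-- `G(log x) x^{-(σ+1)} ∈ L¹(1,∞)` iff `G(t) e^{-σt} ∈ L¹(0,∞)` (real `σ`). [folklore] -/
private theorem integrableOn_comp_log_iff (G : ℝ → ℝ) (σ : ℝ) :
    IntegrableOn (fun x : ℝ ↦ G (Real.log x) * x ^ (-(σ + 1))) (Ioi 1) ↔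
      IntegrableOn (fun t : ℝ ↦ G t * Real.exp (-σ * t)) (Ioi 0) := by
  rw [integrableOn_Ioi_one_iff]
  refine integrableOn_congr_fun (fun t _ ↦ ?_) measurableSet_Ioi
  rw [smul_eq_mul, Real.log_exp, Real.rpow_def_of_pos (Real.exp_pos t), Real.log_exp]
  have : Real.exp t * Real.exp (t * -(σ + 1)) = Real.exp (-σ * t) := by
    rw [← Real.exp_add]
    congr 1
    ring
  rw [← this]
  ring

/-- Complex integrability of `G(t) e^{-σt}` gives real integrability. [folklore] -/
private theorem integrableOn_exp_of_cexp {G : ℝ → ℝ} (hG : Measurable G) {σ : ℝ}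
    (h : IntegrableOn (fun t : ℝ ↦ (G t : ℂ) * cexp (-(σ : ℂ) * t)) (Ioi 0)) :
    IntegrableOn (fun t : ℝ ↦ G t * Real.exp (-σ * t)) (Ioi 0) := by
  have h' : IntegrableOn (fun t : ℝ ↦ ‖(G t : ℂ) * cexp (-(σ : ℂ) * t)‖) (Ioi 0) := h.norm
  have hmeas : AEStronglyMeasurable (fun t : ℝ ↦ G t * Real.exp (-σ * t))
      (volume.restrict (Ioi 0)) :=
    (hG.mul (Real.continuous_exp.measurable.comp (measurable_const.mul measurable_id))).aestronglyMeasurable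
  refine (integrable_norm_iff hmeas).1 (h'.congr_fun (fun t _ ↦ ?_) measurableSet_Ioi)
  dsimp only
  rw [norm_mul, norm_mul, Complex.norm_real, Real.norm_eq_abs,
    ZetaScrewLaplace.norm_cexp_mul_ofReal, Real.norm_of_nonneg (Real.exp_pos _).le]
  simp

/-- `ζ₁(1/2 + s) ≠ 0` for `Re s ≥ 1/2` (no zeros of `ζ` on `Re w ≥ 1`, `ζ₁(1) = 1`). [folklore] -/
private theorem riemannZeta₁_half_add_ne_zero {s : ℂ} (hs : 1 / 2 ≤ s.re) :
    riemannZeta₁ (1 / 2 + s) ≠ 0 :=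
  (riemannZeta₁_ne_zero_of_riemannXi (s := 1 / 2 + s) (by simp; linarith)).2

/-- `ζ₁(1/2 + σ) ≠ 0` for real `σ > 0` (`ζ < 0` on `(0,1)`, `ζ₁(1) = 1`, `ζ ≠ 0` on `[1,∞)`). [folklore] -/
private theorem riemannZeta₁_half_add_ofReal_ne_zero {σ : ℝ} (hσ : 0 < σ) :
    riemannZeta₁ (1 / 2 + σ) ≠ 0 := by
  rcases lt_or_ge σ (1 / 2) with h | h
  · have hne : (1 / 2 : ℂ) + σ ≠ 1 := by
      intro h1
      have := congrArg Complex.re h1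
      simp at this
      linarith
    rw [Ne, riemannZeta₁_eq_zero_iff hne]
    have := riemannZeta_ofReal_ne_zero_of_pos_of_lt_one (1 / 2 + σ) (by linarith) (by linarith)
    push_cast at this
    exact this
  · exact riemannZeta₁_half_add_ne_zero (s := σ) (by simpa using h)

/-- `R(s) = (c(s) ζ₁'/ζ₁(1/2+s) + P(s))/s²` is differentiable at `s ≠ 0` with `ζ₁(1/2+s) ≠ 0`
where `c` and `P` are. [folklore] -/
private theorem differentiableAt_R {c P : ℂ → ℂ} {s : ℂ} (hs0 : s ≠ 0)
    (hζ : riemannZeta₁ (1 / 2 + s) ≠ 0) (hc : DifferentiableAt ℂ c s) (hP : DifferentiableAt ℂ P s) :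
    DifferentiableAt ℂ
      (fun s : ℂ ↦ (c s * logDeriv riemannZeta₁ (1 / 2 + s) + P s) / s ^ 2) s := by
  have hlog : AnalyticAt ℂ (logDeriv riemannZeta₁) (1 / 2 + s) := by
    have h : logDeriv riemannZeta₁ = fun z ↦ deriv riemannZeta₁ z / riemannZeta₁ z := by
      funext z; rw [logDeriv_apply]
    rw [h]
    exact (differentiable_riemannZeta₁.analyticAt _).deriv.div
      (differentiable_riemannZeta₁.analyticAt _) hζ
  have hcomp : DifferentiableAt ℂ (fun s : ℂ ↦ logDeriv riemannZeta₁ (1 / 2 + s)) s :=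
    hlog.differentiableAt.comp s (by fun_prop)
  exact ((hc.mul hcomp).add hP).div (by fun_prop) (pow_ne_zero 2 hs0)

/-- **Landau's theorem in the shape `(c(S)·ζ₁'/ζ₁(1/2+S) + P(S))/S²`** (the tree's engine
`ZetaScrewNonArchSign.riemannHypothesis_of_laplace_eq` with a holomorphic coefficient `c(S)` in front
of `ζ₁'/ζ₁`). Let `G : ℝ → ℝ` be measurable and non-negative on `(t₀, ∞)`, with `G(t)e^{-t}`
integrable on `(0, ∞)`, and suppose that for `Re S > 1` its Laplace transform is
`∫_0^∞ G(t) e^{-St} dt = (c(S)·ζ₁'/ζ₁(1/2 + S) + P(S))/S²` with `c`, `P` holomorphic on `Re S > 0` and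
`c(S) ≠ 0` for `0 < Re S < 1/2`. Then RH holds: by Landau's theorem (Prop. 1 of the paper; the
tree's `Landau.integrableOn_of_differentiableOn_union_convex`) the transform `F` is holomorphic on
`Re S > 0`, whence `(F(S)S² − P(S))·ζ₁(1/2+S) = c(S)·ζ₁'(1/2+S)` there; at a zero `w₀` of
`ζ₁(1/2 + ·)` with `0 < Re w₀ < 1/2` the right side has order `ord(ζ₁(1/2+·)) − 1` (`c(w₀) ≠ 0`), the
left side order `≥ ord(ζ₁(1/2+·))` — impossible; hence `QuasiRiemannHypothesis (1/2)`, i.e. RH.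
[cite: Suzuki2025Chebyshev, §2 Prop 1 and §3.1] -/
theorem riemannHypothesis_of_laplace_eq_mul {G : ℝ → ℝ} (hG : Measurable G) {t₀ : ℝ}
    (hpos : ∀ t : ℝ, t₀ < t → 0 ≤ G t)
    (hint : IntegrableOn (fun t : ℝ ↦ (G t : ℂ) * cexp (-(1 : ℂ) * t)) (Ioi 0))
    {c P : ℂ → ℂ} (hc : DifferentiableOn ℂ c {s : ℂ | 0 < s.re})
    (hc0 : ∀ s : ℂ, 0 < s.re → s.re < 1 / 2 → c s ≠ 0)
    (hP : DifferentiableOn ℂ P {s : ℂ | 0 < s.re})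
    (htr : ∀ s : ℂ, 1 < s.re → ∫ t in Ioi (0 : ℝ), (G t : ℂ) * cexp (-s * t) =
      (c s * logDeriv riemannZeta₁ (1 / 2 + s) + P s) / s ^ 2) :
    RiemannHypothesis := by
  refine quasiRiemannHypothesis_one_half_iff_holds.1 fun w hw h1 h2 ↦ ?_
  -- the zero `w₀ = w - 1/2` of `Z = ζ₁(1/2 + ·)`, with `0 < Re w₀ < 1/2`
  set w₀ : ℂ := w - 1 / 2 with hw₀_def
  have hw₀ : 0 < w₀.re := by simp [hw₀_def]; linarith
  have hw₀' : w₀.re < 1 / 2 := by simp [hw₀_def]; linarith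
  have hw1 : w ≠ 1 := fun h ↦ by rw [h] at h2; simp at h2
  have hzero : riemannZeta₁ (1 / 2 + w₀) = 0 := by
    rw [show (1 / 2 : ℂ) + w₀ = w by rw [hw₀_def]; ring, riemannZeta₁_eq_zero_iff hw1]
    exact hw
  -- the Mellin data
  set g : ℝ → ℝ := fun x ↦ G (Real.log x) with hg_def
  have hg : Measurable g := hG.comp Real.measurable_log
  set R : ℂ → ℂ := fun s ↦ (c s * logDeriv riemannZeta₁ (1 / 2 + s) + P s) / s ^ 2 with hR_def
  set ε : ℝ := w₀.re / 2 with hε_def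
  have hε : 0 < ε := by positivity
  have hε1 : ε < 1 := by rw [hε_def]; linarith
  -- a zero-free thin rectangle around the real segment `[ε/2, 3]`
  set K : Set ℂ := (fun σ : ℝ ↦ (σ : ℂ)) '' Icc (ε / 2) 3 with hK_def
  have hKc : IsCompact K := (isCompact_Icc.image Complex.continuous_ofReal)
  set U : Set ℂ := {s : ℂ | riemannZeta₁ (1 / 2 + s) ≠ 0} with hU_def
  have hUo : IsOpen U := by
    have : U = (fun s : ℂ ↦ riemannZeta₁ (1 / 2 + s)) ⁻¹' {0}ᶜ := rfl
    rw [this]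
    exact isOpen_compl_singleton.preimage
      (differentiable_riemannZeta₁.continuous.comp (by fun_prop))
  have hKU : K ⊆ U := by
    rintro _ ⟨σ, hσ, rfl⟩
    exact riemannZeta₁_half_add_ofReal_ne_zero (by linarith [hσ.1])
  obtain ⟨d₀, hd₀, hthick⟩ := hKc.exists_thickening_subset_open hUo hKU
  set W₀ : Set ℂ := {s : ℂ | ε / 2 < s.re ∧ s.re < 3 ∧ -d₀ < s.im ∧ s.im < d₀} with hW₀_def
  have hW₀eq : W₀ = {s : ℂ | ε / 2 < s.re} ∩ ({s : ℂ | s.re < 3} ∩ ({s : ℂ | -d₀ < s.im} ∩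
      {s : ℂ | s.im < d₀})) := by
    ext s; simp [hW₀_def]
  have hW₀o : IsOpen W₀ := by
    rw [hW₀eq]
    exact (isOpen_lt continuous_const Complex.continuous_re).inter
      ((isOpen_lt Complex.continuous_re continuous_const).inter
        ((isOpen_lt continuous_const Complex.continuous_im).inter
          (isOpen_lt Complex.continuous_im continuous_const)))
  have hW₀c : Convex ℝ W₀ := by
    rw [hW₀eq]
    exact (convex_halfSpace_re_gt _).inter ((convex_halfSpace_re_lt _).inter
      ((convex_halfSpace_im_gt _).inter (convex_halfSpace_im_lt _)))
  have hW₀U : W₀ ⊆ U := by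
    intro s hs
    refine hthick (Metric.mem_thickening_iff.2 ⟨(s.re : ℂ), ⟨s.re, ⟨hs.1.le, hs.2.1.le⟩, rfl⟩, ?_⟩)
    rw [dist_eq_norm]
    have : s - (s.re : ℂ) = (s.im : ℂ) * I := by
      apply Complex.ext <;> simp
    rw [this, norm_mul, Complex.norm_I, mul_one, Complex.norm_real, Real.norm_eq_abs, abs_lt]
    exact ⟨hs.2.2.1, hs.2.2.2⟩
  have hW₀r : ∀ σ : ℝ, ε < σ → σ ≤ 1 + 1 → (σ : ℂ) ∈ W₀ := by
    intro σ h1 h2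
    simp only [hW₀_def, Set.mem_setOf_eq, ofReal_re, ofReal_im, neg_lt_zero]
    exact ⟨by linarith, by linarith, hd₀, hd₀⟩
  have hopen₀ : IsOpen {s : ℂ | 0 < s.re} := isOpen_lt continuous_const Complex.continuous_re
  have hW₀pos : ∀ s ∈ W₀, 0 < s.re := fun s hs ↦ by linarith [hs.1]
  -- `R` is holomorphic on `{Re s > 1} ∪ W₀` and agrees with the transform on `Re s > 1`
  have hΦ : DifferentiableOn ℂ R ({s : ℂ | 1 < s.re} ∪ W₀) := by
    intro s hs
    have hre : 0 < s.re := by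
      rcases hs with hs | hs
      · simp only [Set.mem_setOf_eq] at hs; linarith
      · exact hW₀pos s hs
    have hs0 : s ≠ 0 := fun h0 ↦ by rw [h0, zero_re] at hre; exact lt_irrefl _ hre
    have hζ : riemannZeta₁ (1 / 2 + s) ≠ 0 := by
      rcases hs with hs | hs
      · exact riemannZeta₁_half_add_ne_zero (by simp only [Set.mem_setOf_eq] at hs; linarith)
      · exact hW₀U hs
    exact (differentiableAt_R hs0 hζ (hc.differentiableAt (hopen₀.mem_nhds hre))
      (hP.differentiableAt (hopen₀.mem_nhds hre))).differentiableWithinAt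
  have hagree : EqOn R (Landau.mellinIoi g) {s : ℂ | 1 < s.re} := by
    intro s hs
    simp only [Set.mem_setOf_eq] at hs
    show R s = Landau.mellinIoi (fun x ↦ G (Real.log x)) s
    rw [mellinIoi_comp_log, htr s hs]
  have hint' : IntegrableOn (fun x ↦ g x * x ^ (-((1 : ℝ) + 1))) (Ioi 1) := by
    show IntegrableOn (fun x ↦ G (Real.log x) * x ^ (-((1 : ℝ) + 1))) (Ioi 1)
    rw [integrableOn_comp_log_iff]
    refine integrableOn_exp_of_cexp hG (σ := 1) ?_
    simpa using hint
  set X₁ : ℝ := Real.exp (max t₀ 0) with hX₁_def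
  have hX₁ : 1 ≤ X₁ := Real.one_le_exp (le_max_right _ _)
  have hpos' : ∀ x : ℝ, X₁ < x → 0 ≤ g x := by
    intro x hx
    have hx0 : 0 < x := lt_trans (Real.exp_pos _) hx
    refine hpos _ (lt_of_le_of_lt (le_max_left t₀ 0) ?_)
    rw [← Real.log_exp (max t₀ 0)]
    exact Real.log_lt_log (Real.exp_pos _) hx
  -- Landau: absolute convergence for every `σ > ε`, holomorphy of `F` on `Re s > ε`
  have hS : ∀ σ' : ℝ, ε < σ' → IntegrableOn (fun x ↦ g x * x ^ (-(σ' + 1))) (Ioi 1) :=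
    fun σ' hσ' ↦ Landau.integrableOn_of_differentiableOn_union_convex hg hint' hX₁ hpos'
      hε1 hW₀o hW₀c hW₀r hΦ hagree hσ'
  set F : ℂ → ℂ := Landau.mellinIoi g with hF_def
  have hFdiff : DifferentiableOn ℂ F {s : ℂ | ε < s.re} :=
    Landau.differentiableOn_mellinIoi_of_forall hg hS
  set H : Set ℂ := {s : ℂ | ε < s.re} with hH_def
  have hHo : IsOpen H := isOpen_lt continuous_const Complex.continuous_re
  have hHpre : IsPreconnected H := (convex_halfSpace_re_gt ε).isPreconnected
  have hH₀ : H ⊆ {s : ℂ | 0 < s.re} := fun s hs ↦ by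
    simp only [hH_def, Set.mem_setOf_eq] at hs ⊢; linarith
  -- the identity `(F(s) s² − P(s)) ζ₁(1/2+s) = c(s) ζ₁'(1/2+s)` on `H`
  set Z : ℂ → ℂ := fun s ↦ riemannZeta₁ (1 / 2 + s) with hZ_def
  have hZd : Differentiable ℂ Z := differentiable_riemannZeta₁.comp (by fun_prop)
  have hZa : ∀ s, AnalyticAt ℂ Z s := fun s ↦ hZd.analyticAt s
  have hderivZ : ∀ s, deriv Z s = deriv riemannZeta₁ (1 / 2 + s) := fun s ↦ by
    simp only [hZ_def]
    exact deriv_comp_const_add riemannZeta₁ (1 / 2) s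
  have hca : ∀ s ∈ H, AnalyticAt ℂ c s := fun s hs ↦ hc.analyticAt (hopen₀.mem_nhds (hH₀ hs))
  set G₁ : ℂ → ℂ := fun s ↦ F s * s ^ 2 - P s with hG₁_def
  have hGa : ∀ s ∈ H, AnalyticAt ℂ G₁ s := fun s hs ↦
    (((hFdiff.analyticOnNhd hHo) s hs).mul (analyticAt_id.pow 2)).sub
      (hP.analyticAt (hopen₀.mem_nhds (hH₀ hs)))
  have hf₁ : AnalyticOnNhd ℂ (G₁ * Z) H := fun s hs ↦ (hGa s hs).mul (hZa s)
  have hf₂ : AnalyticOnNhd ℂ (c * deriv Z) H := fun s hs ↦ (hca s hs).mul (hZa s).deriv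
  have h2H : (2 : ℂ) ∈ H := by simp [hH_def]; linarith
  have hev2 : (G₁ * Z) =ᶠ[𝓝 (2 : ℂ)] c * deriv Z := by
    have hopen : IsOpen {s : ℂ | 1 < s.re} := isOpen_lt continuous_const Complex.continuous_re
    filter_upwards [hopen.mem_nhds (show (2 : ℂ) ∈ {s : ℂ | 1 < s.re} by simp)] with s hs
    have hs' : 1 < s.re := hs
    have hζ : riemannZeta₁ (1 / 2 + s) ≠ 0 := riemannZeta₁_half_add_ne_zero (by linarith)
    have hs0 : s ≠ 0 := fun h ↦ by rw [h, zero_re] at hs'; linarith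
    rw [Pi.mul_apply, Pi.mul_apply, hderivZ s]
    simp only [hG₁_def, hZ_def]
    rw [← hagree hs]
    simp only [hR_def]
    rw [logDeriv_apply]
    set A : ℂ := deriv riemannZeta₁ (1 / 2 + s)
    set B : ℂ := riemannZeta₁ (1 / 2 + s)
    field_simp
    ring
  have hEqOn : EqOn (G₁ * Z) (c * deriv Z) H :=
    hf₁.eqOn_of_preconnected_of_eventuallyEq hf₂ hHpre h2H hev2
  -- orders at `w₀`
  have hw₀H : w₀ ∈ H := by simp [hH_def, hε_def]; linarith
  have hev : c * deriv Z =ᶠ[𝓝 w₀] G₁ * Z := by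
    filter_upwards [hHo.mem_nhds hw₀H] with s hs
    exact (hEqOn hs).symm
  have hZ0 : Z w₀ = 0 := hzero
  have hc_ord : analyticOrderAt c w₀ = 0 :=
    (hca w₀ hw₀H).analyticOrderAt_eq_zero.2 (hc0 w₀ hw₀ hw₀')
  have h1 : analyticOrderAt (deriv Z) w₀ + 1 = analyticOrderAt Z w₀ := by
    have := (hZa w₀).analyticOrderAt_deriv_add_one
    simpa [hZ0] using this
  have h2 : analyticOrderAt (c * deriv Z) w₀ = analyticOrderAt G₁ w₀ + analyticOrderAt Z w₀ := by
    rw [analyticOrderAt_congr hev, analyticOrderAt_mul (hGa w₀ hw₀H) (hZa w₀)]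
  have h3 : analyticOrderAt (c * deriv Z) w₀ = analyticOrderAt (deriv Z) w₀ := by
    rw [analyticOrderAt_mul (hca w₀ hw₀H) (hZa w₀).deriv, hc_ord, zero_add]
  rw [h3] at h2
  rw [h2] at h1
  -- `Z` is not locally zero (`ζ₁(1) = 1`), so its order is finite: contradiction
  generalize hoZ : analyticOrderAt Z w₀ = oZ at h1
  generalize hoG : analyticOrderAt G₁ w₀ = oG at h1
  cases oZ with
  | top =>
    have hloc : ∀ᶠ s in 𝓝 w₀, Z s = 0 := analyticOrderAt_eq_top.1 hoZ
    have hall : EqOn Z 0 univ :=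
      (hZd.differentiableOn.analyticOnNhd isOpen_univ).eqOn_zero_of_preconnected_of_eventuallyEq_zero
        isPreconnected_univ (Set.mem_univ w₀) hloc
    have h1' : Z (1 / 2) = 0 := hall (Set.mem_univ _)
    simp only [hZ_def] at h1'
    rw [show (1 / 2 : ℂ) + 1 / 2 = 1 by norm_num, riemannZeta₁_one] at h1'
    exact one_ne_zero h1'
  | coe n =>
    cases oG with
    | top => simp at h1
    | coe m =>
      have h' : (m + n + 1 : ℕ) = n := by exact_mod_cast h1
      omega

end HalfLinePrimeSumLandau

/-! ## Theorem 2 (first assertion) -/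

/-- **Suzuki 2025, Theorem 2 (first assertion), AS PRINTED** (Ramanujan J. 68:95 = arXiv:2411.07436,
Thm. 2, p. 3): «Suppose that there exists an `x₀ ≥ 2` such that
`Σ_{n ≤ xe²} Λ(n) n^{-1/2} log(x/n) ≤ 0` holds for all `x ≥ x₀`. Then, the RH holds.»
(The sum is over `1 ≤ n ≤ ⌊xe²⌋`.) RH-FREE implication whose hypothesis is of at least RH strength
(p. 3: it «may provide a condition stronger than the RH»; the paper's second assertion — the
equivalence of the limit form (1.11) with RH **and** `Σ_ρ x^ρ/ρ = o(√x log x)` — is not formalised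
here). Proof: §3.1 of the paper with `4√x` replaced by `2Σ_{n ≤ x}Λ(n)/√n` — in `y = xe² = e^t` the
hypothesis is `2Π(t) − φ(t) ≥ 0` for `t ≥ log x₀ + 2`, whose Laplace transform is
`((1 − 2S)ζ₁'/ζ₁(1/2+S) + 2)/S²` (`HalfLinePrimeSumLandau.laplace_two_primeCount_sub_primeSum`), and
Landau's theorem (`HalfLinePrimeSumLandau.riemannHypothesis_of_laplace_eq_mul`) applies since
`1 − 2S ≠ 0` for `Re S < 1/2`. [cite: Suzuki2025Chebyshev, Thm 2 (first assertion); proof §3.1] -/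
theorem Suzuki2025_thm2
    (h : ∃ x₀ : ℝ, 2 ≤ x₀ ∧ ∀ x : ℝ, x₀ ≤ x →
      ∑ n ∈ Finset.Icc 1 ⌊x * Real.exp 2⌋₊, Λ n / Real.sqrt n * Real.log (x / n) ≤ 0) :
    RiemannHypothesis := by
  obtain ⟨x₀, hx₀, h⟩ := h
  have hx₀0 : 0 < x₀ := by linarith
  set G : ℝ → ℝ := fun t ↦
    2 * (∑ n ∈ Finset.Icc 1 ⌊Real.exp t⌋₊, Λ n / Real.sqrt n) - zetaScrewPrimeSum t with hG_def
  have hGm : Measurable G :=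
    (HalfLinePrimeSumLandau.measurable_primeCount.const_mul 2).sub
      continuous_zetaScrewPrimeSum.measurable
  refine HalfLinePrimeSumLandau.riemannHypothesis_of_laplace_eq_mul (G := G) hGm
    (t₀ := Real.log x₀ + 2) (fun t ht ↦ ?_) ?_ (c := fun s ↦ 1 - 2 * s) (P := fun _ ↦ 2)
    (by fun_prop) (fun s _ hs' hcs ↦ ?_) (by fun_prop) (fun s hs ↦ ?_)
  · -- non-negativity beyond `log x₀ + 2`, from the hypothesis at `x = e^{t−2}`
    have hlog2 : 0 < Real.log x₀ + 2 := by
      have := Real.log_nonneg (show (1 : ℝ) ≤ x₀ by linarith)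
      linarith
    have ht0 : 0 ≤ t := by linarith
    set x : ℝ := Real.exp (t - 2) with hx_def
    have hx₀x : x₀ ≤ x := by
      rw [hx_def, ← Real.exp_log hx₀0]
      exact Real.exp_le_exp.2 (by linarith)
    have hx0 : 0 < x := Real.exp_pos _
    have hxe : x * Real.exp 2 = Real.exp t := by
      rw [hx_def, ← Real.exp_add]
      congr 1
      ring
    have hyp := h x hx₀x
    rw [hxe] at hyp
    have hG : G t = -∑ n ∈ Finset.Icc 1 ⌊Real.exp t⌋₊, Λ n / Real.sqrt n * Real.log (x / n) := by
      simp only [hG_def, zetaScrewPrimeSum, abs_of_nonneg ht0]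
      rw [Finset.mul_sum, ← Finset.sum_sub_distrib, ← Finset.sum_neg_distrib]
      refine Finset.sum_congr rfl fun n hn ↦ ?_
      rw [Finset.mem_Icc] at hn
      have hn0 : (n : ℝ) ≠ 0 := by exact_mod_cast (show n ≠ 0 by omega)
      rw [Real.log_div hx0.ne' hn0, hx_def, Real.log_exp]
      ring
    rw [hG, neg_nonneg]
    exact hyp
  · -- integrability of `G(t) e^{−t}`
    have := HalfLinePrimeSumLandau.integrableOn_two_primeCount_sub_primeSum_mul_cexp
      (a := -1) (by norm_num)
    simpa [hG_def] using this
  · -- `c(S) = 1 − 2S ≠ 0` for `Re S < 1/2`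
    have := congrArg Complex.re (sub_eq_zero.1 hcs)
    simp at this
    linarith
  · -- the transform
    have := (HalfLinePrimeSumLandau.laplace_two_primeCount_sub_primeSum hs).2
    simpa [hG_def] using this

end Literature.NumberTheory.LFunctions
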